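import Summits.QuantumFields.BalabanUV.Beta.D1BFx.LamPartnerLetters
import Summits.QuantumFields.BalabanUV.Beta.D1BFx.KernelWardInsertionZero
import Summits.QuantumFields.BalabanUV.Beta.D1BFx.LamCoeffMoments
import Summits.QuantumFields.BalabanUV.Beta.D1BFx.DressedBubbleTable

/-!
# `BalabanUV.Beta.D1BFx.LamPartnerZero` — road «BF-x» for binder row D1, slot (K), census group **G_Λ**: THE ZERO-MOMENTUM LETTERS `hZeroν`∕`hZeroμ`
# OF THE PARTNER FUNCTIONALS `LamDictionary.Nrν`∕`Nrμ` FROM THE ROAD's COVARIANCE LETTERS (W1)∕(W2′) — `Σ'_{u′} Nr• m 0 u′ = 0`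
# (owner ruling ρ-g9-22 «HZERO-DISCHARGE»; an3-g53 §6 (Z-a)(Z-b)(Z-c); junction J-an3-g54-1, option (β))

HONEST DEPENDENCY (page 1, mandatory): continuum YM on T⁴ ⇐ BetaPertH ∧ nine spine estimates (0/9 proved); BetaPertH ⇐ (D1) ∧ (D4) ∧
CAP+tail; G-an2-4 gates asym, D1 and NE2/3/4.  HONEST FRAMING (cell contract, verbatim): «discharging `BetaPertH` makes Bałaban's UV
stability UNCONDITIONAL — a real constructive-QFT result; it is NOT the continuum limit and NOT the Clay problem.»  THIS MODULE DISCHARGES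
NOTHING of the wall: [folklore] `tsum`∕Fubini bookkeeping BY NAME over landed bricks — the owner's zero-total law
`KernelWardInsertionZero.tsum_resp_eq_zero` (instantiated at blocking `N := 1`: the vertex family is the road's FULL first-order stencil on the fine
bonds, the insertion is the Λ-companion `ffOf (hessFF n m 0)`, its jet is the Λ₂-companion `TΛ m 0`), the census identity (I)
`LamCoeffAffineNull.tsum_affine_mul_lamCoeffOf` (the `cΛ²` cross term), `LamSectorUnfold.bubble_SbL_left`, `LamPartnerLetters.*`.  The two covariance
letters (W1) (the operator's, for `ε • SbfBal`) and (W2′) (the insertion's, for `(cΛ₂∕cΛ) • TΛ`, = an1's `MixedWardPackingFF.w2p_sym_ff` once `TΛ` is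
instantiated — J-an3-g54-1) and the generator's localisation `hX` are DISPLAYED HYPOTHESES, not proved here.  No definition, no `def … : Prop`,
nothing cited, 0 sorry.  0 wall binders (root-level hW ∕ hR-sockets ∕ hSX-socket ∕ D1Tel ∕ D1Rep — 0 discharged); (K) NOT closed; NOT D1, NOT
`BetaPertH`, NOT continuum, NOT Clay.

ABSOLUTE RULE (cell charter, verbatim): «No internally-minted statement may enter as a cited fact. Every hypothesis is either kernel-proved in
this package or a verbatim quotation of a PUBLISHED theorem with page reference. The manuscript(s) under audit are NOT citable for their own
disputed steps — they are the thing under adjudication; programme-internal (2001/route/tribunal) claims are never citable.»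

CONTENT ([folklore]; `G := Ga n a`, `Y := ffOf (hessFF n m 0)`).
* §1 summability over the fine site of the three scalar families at the base block: the full-stencil bubble `u ↦ bubble G (SbfBal κ u) Y`
  (both slot orders), the Λ-sector bubble `u ↦ bubble G (SbL n κ u) Y`, the companion tadpole `u ↦ tadpole G (TΛ m 0 κ u)`.
* §2 (Z-a) **`tsum_bubble_SbL_eq_zero`**: `Σ'_u bubble G (SbL n κ u) Y = 0` — Λ-unfolding, Fubini, and the monopole null of `Λ′`.
* §3 (Z-b)(Z-c) **`tsum_Nrν_eq_zero`**, **`tsum_Nrμ_eq_zero`**: `Σ'_{u′} Nr• m 0 u′ = 0` under (W1), (W2′), `hX`, `cΛ ≠ 0`, `ε = ±1` and the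
  Λ₂-companion's localisation socket `hTloc` — the `hZero•` hypotheses of `RoadEndLamRow.gLam_row_eq_zero`, BY NAME.
Unit `b2b-balaban-beta-d1-formalise-leaf-04` (gen 8); `LEAVES-BFx.md` row «HZERO-DISCHARGE».
-/

noncomputable section

namespace Summit.QuantumFields.BalabanUV.Beta.D1BFx.LamPartnerZero

open Finset
open scoped BigOperators
open Literature.MathematicalPhysics.QuantumFieldTheory
open Literature.MathematicalPhysics.QuantumFieldTheory.Balaban1983to89
open Literature.MathematicalPhysics.QuantumFieldTheory.Balaban1983to89.Beta
open B12Sec2to5 (l1 l1_nonneg)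
open ExpKernelCalculus (Site MKer Decays BiLoc VertexFamily bubble tadpole comp Zl Zl_nonneg summable_exp_shift' tsum_exp_shift' l1_sub_symm)
open OneStepResolventKernel (Fib KInv decays_KInv)
open AveragingHessianKernels (hessFF biLoc_hessFF)
open BalabanStepJets (lamCoeffOf)
open KernelWard (divV biLoc_recentre biLoc_sub)
open StepJetData (biLoc_smul)
open KernelReflection (bubble_smul_left tadpole_smul)
open Summit.QuantumFields.BalabanUV.Beta.TameKernelCalculus (Spr Loc biLoc_of_le decays_of_le)
open Summit.QuantumFields.BalabanUV.Beta.KernelWardRelative (bubble_sub_left)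
open Summit.QuantumFields.BalabanUV.Beta.D1BFx.FineStencilBF (ffOf biLoc_ffOf)
open Summit.QuantumFields.BalabanUV.Beta.D1BFx.GluonLeg (Ga)
open Summit.QuantumFields.BalabanUV.Beta.D1BFx.GluonKernelSectors (SbL)
open Summit.QuantumFields.BalabanUV.Beta.D1BFx.FineStencilBFBalaban (SbfBal exists_biLoc_SbfBal)
open Summit.QuantumFields.BalabanUV.Beta.D1BFx.LamSectorUnfold (bubble_SbL_left exists_abs_lamCoeff_KInv_le)
open Summit.QuantumFields.BalabanUV.Beta.D1BFx.LamCoeffAffineNull (tsum_affine_mul_lamCoeffOf)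
open Summit.QuantumFields.BalabanUV.Beta.D1BFx.LamDictionary (Nrν Nrμ summable_exp_zsmul)
open Summit.QuantumFields.BalabanUV.Beta.D1BFx.LamPartnerLetters (abs_bubble_le_exp SbfBal_sub_SbL_eq exists_bubble_Y_decay exists_tadpole_T_decay)
open Summit.QuantumFields.BalabanUV.Beta.D1BFx.DressedBubbleTable (bubble_comm)
open Summit.QuantumFields.BalabanUV.Beta.D1BFx.KernelWardInsertionZero (tsum_resp_eq_zero)

variable (n : ℕ) [NeZero n] (a : ℝ) (cE cVH cΛ cR cK cQ cΛ₂ ωgl : ℝ) {TΛ : Fin 4 → Site 4 → Fin 4 → Site 4 → MKer 4 (Fin 4)} {CT δT : ℝ}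

/-! ## §1 Summability over the fine site at the base block -/

section Summability

variable {a}

omit [NeZero n] in
/-- [folklore] A scalar family dominated by `K·e^{−δ·|n•0 − u|₁}` is summable over the fine site. -/
theorem summable_of_decay_base {f : Site 4 → ℝ} {K δ : ℝ} (hδ : 0 < δ) (hf : ∀ u, |f u| ≤ K * Real.exp (-δ * l1 ((n : ℤ) • (0 : Site 4) - u))) :
    Summable f := by
  refine Summable.of_norm_bounded ((summable_exp_shift' (D := 4) hδ 0).mul_left K) fun u => ?_
  rw [Real.norm_eq_abs]
  have h := hf u
  rwa [smul_zero, l1_sub_symm, show u - (0 : Site 4) = u - 0 from rfl] at h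

/-- [folklore] The full-stencil bubble against the base Λ-companion is summable over the fine site (companion in the second slot). -/
theorem summable_bubble_SbfBal (ha : 0 < a) (hGa : Spr (Ga n a)) (c : ℝ) (κ m : Fin 4) :
    Summable fun u : Site 4 => bubble (Ga n a) (SbfBal n a cE cVH c cR cK cQ κ u) (ffOf (hessFF n m 0)) := by
  obtain ⟨Cf, δf, hδf, hSf⟩ := exists_biLoc_SbfBal n a ha cE cVH c cR cK cQ
  obtain ⟨KB, δB, -, hδB, hB, -⟩ := exists_bubble_Y_decay n hGa hδf hSf κ
  exact summable_of_decay_base n hδB fun u => hB m 0 u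

/-- [folklore] The same with the companion in the first slot. -/
theorem summable_bubble_SbfBal' (ha : 0 < a) (hGa : Spr (Ga n a)) (c : ℝ) (κ m : Fin 4) :
    Summable fun u : Site 4 => bubble (Ga n a) (ffOf (hessFF n m 0)) (SbfBal n a cE cVH c cR cK cQ κ u) := by
  obtain ⟨Cf, δf, hδf, hSf⟩ := exists_biLoc_SbfBal n a ha cE cVH c cR cK cQ
  obtain ⟨KB, δB, -, hδB, -, hB⟩ := exists_bubble_Y_decay n hGa hδf hSf κ
  exact summable_of_decay_base n hδB fun u => hB m 0 u

/-- [folklore] The Λ₂-companion tadpole at the base block is summable over the fine site. -/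
theorem summable_tadpole_T (hGa : Spr (Ga n a)) (hδT : 0 < δT)
    (hTloc : ∀ m y κ u, BiLoc (TΛ m y κ u) ((n : ℤ) • y) ((n : ℤ) • y) (CT * Real.exp (-δT * l1 ((n : ℤ) • y - u))) δT) (κ m : Fin 4) :
    Summable fun u : Site 4 => tadpole (Ga n a) (TΛ m 0 κ u) := by
  obtain ⟨KT, δT', -, hδT', hT⟩ := exists_tadpole_T_decay n hGa hδT hTloc κ
  exact summable_of_decay_base n hδT' fun u => hT m 0 u

/-- [folklore] The Λ-sector stencil is a difference of two full stencils: `cΛ • SbL n κ u = S(cΛ) κ u − S(0) κ u` (`SbfBal_sub_SbL_eq`). -/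
theorem smul_SbL_eq (κ : Fin 4) (u : Site 4) :
    cΛ • SbL n κ u = SbfBal n a cE cVH cΛ cR cK cQ κ u - SbfBal n a cE cVH 0 cR cK cQ κ u := by
  rw [← SbfBal_sub_SbL_eq (n := n) (a := a) (cE := cE) (cVH := cVH) (cΛ := cΛ) (cR := cR) (cK := cK) (cQ := cQ) κ u]
  abel

/-- [folklore] `Loc` of the road's full stencil at a fine bond. -/
theorem loc_SbfBal (ha : 0 < a) (c : ℝ) (κ : Fin 4) (u : Site 4) : Loc (SbfBal n a cE cVH c cR cK cQ κ u) := by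
  obtain ⟨Cf, δf, hδf, hSf⟩ := exists_biLoc_SbfBal n a ha cE cVH c cR cK cQ
  exact ⟨u, u, Cf, δf, hδf, hSf κ u⟩

/-- [folklore] `Loc` of the Λ-companion. -/
theorem loc_Y (m : Fin 4) (y : Site 4) : Loc (ffOf (hessFF n m y)) :=
  ⟨(n : ℤ) • y, (n : ℤ) • y, _, 1, one_pos, biLoc_ffOf (biLoc_hessFF (d := 3) (L := n) NeZero.one_le m y zero_le_one)⟩

/-- [folklore] **THE `cΛ`-WEIGHTED Λ-SECTOR BUBBLE IS THE DIFFERENCE OF TWO FULL-STENCIL BUBBLES.** -/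
theorem cΛ_mul_bubble_SbL (ha : 0 < a) (hGa : Spr (Ga n a)) (κ m : Fin 4) (u : Site 4) :
    cΛ * bubble (Ga n a) (SbL n κ u) (ffOf (hessFF n m 0)) =
      bubble (Ga n a) (SbfBal n a cE cVH cΛ cR cK cQ κ u) (ffOf (hessFF n m 0)) -
        bubble (Ga n a) (SbfBal n a cE cVH 0 cR cK cQ κ u) (ffOf (hessFF n m 0)) := by
  rw [← bubble_smul_left, smul_SbL_eq n cE cVH cΛ cR cK cQ κ u,
    bubble_sub_left hGa (loc_SbfBal n cE cVH cR cK cQ ha cΛ κ u) (loc_SbfBal n cE cVH cR cK cQ ha 0 κ u) (loc_Y n m 0)]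

end Summability

/-! ## §2 (Z-a) The `cΛ²` cross term: the Λ-sector bubble has zero total over the fine site -/

section CrossTerm

variable {a}

/-- [folklore] **(Z-a) THE Λ-SECTOR BUBBLE AGAINST THE BASE COMPANION HAS ZERO TOTAL**: `Σ'_u bubble G (SbL n κ u) (Y m 0) = 0` — an3's Λ-unfolding
`bubble_SbL_left` (`= −Σ_{m′} Σ'_y Λ′_{m′,y}(κ,u)·bubble G (Y m′ y) (Y m 0)`), Fubini over `(y, u)` (the Y–Y bubble decays in `|n•y|₁` by `abs_bubble_le_exp`,
`Λ′` in `|n•y − u|₁`), and the monopole null `Σ'_u Λ′_{m′,y}(κ,u) = 0` = census identity (I) `tsum_affine_mul_lamCoeffOf` (p250824) at the constant weight. -/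
theorem tsum_bubble_SbL_eq_zero (hGa : Spr (Ga n a)) (κ m : Fin 4) :
    ∑' u : Site 4, bubble (Ga n a) (SbL n κ u) (ffOf (hessFF n m 0)) = 0 := by
  have hn : 1 ≤ n := NeZero.one_le
  have hN0 : (n : ℤ) ≠ 0 := by exact_mod_cast NeZero.ne n
  -- the Λ-unfolding
  have hunf : ∀ u : Site 4, bubble (Ga n a) (SbL n κ u) (ffOf (hessFF n m 0)) =
      -∑ m' : Fin 4, ∑' y : Site 4, lamCoeffOf (KInv (N := n) (d := 3)) n m' y κ u *
        bubble (Ga n a) (ffOf (hessFF n m' y)) (ffOf (hessFF n m 0)) := fun u => bubble_SbL_left n hGa (loc_Y n m 0) κ u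
  simp only [hunf]
  -- decay of the two factors
  obtain ⟨CΛ, δΛ, hCΛ, hδΛ, hΛ⟩ := exists_abs_lamCoeff_KInv_le n
  obtain ⟨CA, δA, hδA, hAd⟩ := hGa
  set δ₀ : ℝ := min δA 1 with hδ₀def
  have hδ₀ : 0 < δ₀ := lt_min hδA one_pos
  have hA : Decays (Ga n a) (|CA|) δ₀ := decays_of_le hAd (min_le_left _ _)
  obtain ⟨CY, hY⟩ : ∃ CY : ℝ, ∀ (m' : Fin 4) (y : Site 4), BiLoc (ffOf (hessFF n m' y)) ((n : ℤ) • y) ((n : ℤ) • y) CY δ₀ :=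
    ⟨_, fun m' y => biLoc_ffOf (biLoc_hessFF (d := 3) (L := n) hn m' y hδ₀.le)⟩
  set Kb : ℝ := (Fintype.card (Fin 4) : ℝ) * ((Fintype.card (Fin 4) : ℝ) * (((Fintype.card (Fin 4) : ℝ) * (|CA| * CY) * Zl 4 (δ₀ - δ₀ / 2)) *
      ((Fintype.card (Fin 4) : ℝ) * (|CA| * CY) * Zl 4 (δ₀ - δ₀ / 2))) * Zl 4 (δ₀ / 2 / 2)) * Zl 4 (δ₀ / 2 / 2) with hKb
  have hb : ∀ (m' : Fin 4) (y : Site 4), |bubble (Ga n a) (ffOf (hessFF n m' y)) (ffOf (hessFF n m 0))| ≤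
      Kb * Real.exp (-(δ₀ / 2 / 2) * l1 ((n : ℤ) • y - 0)) := by
    intro m' y
    have h := abs_bubble_le_exp (hA) (hY m' y) (hY m 0) hδ₀
    rwa [smul_zero] at h
  have hCY : 0 ≤ CY := (hY 0 0).nonneg (0 : Fin 4)
  have hKb0 : 0 ≤ Kb := by
    have h1 := Zl_nonneg (D := 4) (show 0 < δ₀ - δ₀ / 2 by linarith)
    have h2 := Zl_nonneg (D := 4) (show 0 < δ₀ / 2 / 2 by positivity)
    positivity
  -- joint summability of the `(y, u)` family, for each `m'`
  have hS : ∀ m' : Fin 4, Summable (Function.uncurry fun (y : Site 4) (u : Site 4) =>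
      lamCoeffOf (KInv (N := n) (d := 3)) n m' y κ u * bubble (Ga n a) (ffOf (hessFF n m' y)) (ffOf (hessFF n m 0))) := by
    intro m'
    have hf : Summable fun y : Site 4 => Kb * Real.exp (-(δ₀ / 2 / 2) * l1 ((n : ℤ) • y - 0)) :=
      (summable_exp_zsmul n (by positivity) 0).mul_left Kb
    have hg : Summable fun z : Site 4 => CΛ * Real.exp (-δΛ * l1 z) := by
      simpa only [sub_zero] using (summable_exp_shift' (D := 4) hδΛ 0).mul_left CΛ
    have hmaj := hf.mul_of_nonneg hg (fun y => mul_nonneg hKb0 (Real.exp_pos _).le) (fun z => mul_nonneg hCΛ (Real.exp_pos _).le)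
    set e : Site 4 × Site 4 ≃ Site 4 × Site 4 := Equiv.prodShear (Equiv.refl _) (fun y => Equiv.addRight ((n : ℤ) • y)) with he
    refine (e.summable_iff).mp (Summable.of_norm_bounded hmaj fun q => ?_)
    rcases q with ⟨y, z⟩
    rw [Real.norm_eq_abs]
    have h1 := hΛ m' y κ (z + (n : ℤ) • y)
    rw [show (n : ℤ) • y - (z + (n : ℤ) • y) = -z by abel, LamFactor.l1_neg] at h1
    have h2 := hb m' y
    have e1 : ((Function.uncurry fun (y : Site 4) (u : Site 4) =>
        lamCoeffOf (KInv (N := n) (d := 3)) n m' y κ u * bubble (Ga n a) (ffOf (hessFF n m' y)) (ffOf (hessFF n m 0))) ∘ e) (y, z) =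
        lamCoeffOf (KInv (N := n) (d := 3)) n m' y κ (z + (n : ℤ) • y) * bubble (Ga n a) (ffOf (hessFF n m' y)) (ffOf (hessFF n m 0)) := by
      simp [he, Equiv.prodShear, Function.uncurry]
    rw [e1, abs_mul]
    show _ ≤ Kb * Real.exp (-(δ₀ / 2 / 2) * l1 ((n : ℤ) • y - 0)) * (CΛ * Real.exp (-δΛ * l1 z))
    calc |lamCoeffOf (KInv (N := n) (d := 3)) n m' y κ (z + (n : ℤ) • y)| * |bubble (Ga n a) (ffOf (hessFF n m' y)) (ffOf (hessFF n m 0))|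
        ≤ (CΛ * Real.exp (-δΛ * l1 z)) * (Kb * Real.exp (-(δ₀ / 2 / 2) * l1 ((n : ℤ) • y - 0))) :=
          mul_le_mul h1 h2 (abs_nonneg _) (by positivity)
      _ = Kb * Real.exp (-(δ₀ / 2 / 2) * l1 ((n : ℤ) • y - 0)) * (CΛ * Real.exp (-δΛ * l1 z)) := by ring
  -- Fubini and the monopole null
  obtain ⟨δ, C, hδ, hC, hKd⟩ := decays_KInv (N := n) (d := 3)
  have hnull : ∀ (m' : Fin 4) (y : Site 4), ∑' u : Site 4, lamCoeffOf (KInv (N := n) (d := 3)) n m' y κ u = 0 := by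
    intro m' y
    have h := tsum_affine_mul_lamCoeffOf hKd hC hδ (fun _ => (0 : ℝ)) 1 n m' y κ
    simpa only [zero_mul, Finset.sum_const_zero, zero_add, one_mul] using h
  have hin : ∀ m' : Fin 4, ∑' u : Site 4, ∑' y : Site 4, lamCoeffOf (KInv (N := n) (d := 3)) n m' y κ u *
      bubble (Ga n a) (ffOf (hessFF n m' y)) (ffOf (hessFF n m 0)) = 0 := by
    intro m'
    rw [(hS m').tsum_comm]
    refine (tsum_congr fun y => ?_).trans tsum_zero
    rw [tsum_mul_right, hnull m' y, zero_mul]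
  have hsum : ∀ m' : Fin 4, Summable fun u : Site 4 => ∑' y : Site 4, lamCoeffOf (KInv (N := n) (d := 3)) n m' y κ u *
      bubble (Ga n a) (ffOf (hessFF n m' y)) (ffOf (hessFF n m 0)) := fun m' => (hS m').prod_symm.prod
  rw [tsum_neg, Summable.tsum_finsetSum (fun m' _ => hsum m')]
  simp only [hin, Finset.sum_const_zero, neg_zero]

/-- [folklore] The Λ-sector bubble is summable over the fine site. -/
theorem summable_bubble_SbL (ha : 0 < a) (hGa : Spr (Ga n a)) (hcΛ : cΛ ≠ 0) (κ m : Fin 4) :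
    Summable fun u : Site 4 => bubble (Ga n a) (SbL n κ u) (ffOf (hessFF n m 0)) := by
  -- any values of the other sector weights realise `cΛ • SbL` as a difference of two full stencils; take them `0`
  have h := ((summable_bubble_SbfBal n 0 0 0 0 0 ha hGa cΛ κ m).sub (summable_bubble_SbfBal n 0 0 0 0 0 ha hGa 0 κ m)).mul_left cΛ⁻¹
  refine h.congr fun u => ?_
  show cΛ⁻¹ * (bubble (Ga n a) (SbfBal n a 0 0 cΛ 0 0 0 κ u) (ffOf (hessFF n m 0)) -
      bubble (Ga n a) (SbfBal n a 0 0 0 0 0 0 κ u) (ffOf (hessFF n m 0))) = _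
  rw [← cΛ_mul_bubble_SbL n 0 0 cΛ 0 0 0 ha hGa κ m u, ← mul_assoc, inv_mul_cancel₀ hcΛ, one_mul]

end CrossTerm

/-! ## §3 (Z-b)(Z-c) The zero-momentum letters of the two partner functionals -/

section Zero

variable {a}

/-- [folklore] **THE WARD TOTAL AT BLOCKING ONE** (owner's `tsum_resp_eq_zero`, instantiated): with the road's full stencil `V := ε • SbfBal` as the
vertex family on the FINE bonds (`N := 1`), the base Λ-companion `Y := ffOf (hessFF n m 0)` as the insertion (site `Q := 0`) and the scaled
Λ₂-companion `Z := c • TΛ m 0` as its jet, the covariance letters (W1)∕(W2′) give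
`c · Σ'_u tadpole G (TΛ m 0 α u) = ε · Σ'_u bubble G (SbfBal α u) Y`. -/
theorem ward_total (ha : 0 < a) (hGa : Spr (Ga n a)) (hδT : 0 < δT)
    (hTloc : ∀ m y κ u, BiLoc (TΛ m y κ u) ((n : ℤ) • y) ((n : ℤ) • y) (CT * Real.exp (-δT * l1 ((n : ℤ) • y - u))) δT)
    (ε c : ℝ) {X : Site 4 → MKer 4 (Fin 4)} {Cx δx : ℝ} (hδx : 0 < δx) (hX : ∀ u, BiLoc (X u) u u Cx δx)
    (hW1 : ∀ u, comp (comp (Ga n a) (divV (fun κ v => ε • SbfBal n a cE cVH cΛ cR cK cQ κ v) u)) (Ga n a) =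
      comp (Ga n a) (X u) - comp (X u) (Ga n a))
    (m : Fin 4)
    (hW2 : ∀ u, divV (fun κ v => c • TΛ m 0 κ v) u = comp (X u) (ffOf (hessFF n m 0)) - comp (ffOf (hessFF n m 0)) (X u))
    (α : Fin 4) :
    c * ∑' u : Site 4, tadpole (Ga n a) (TΛ m 0 α u) =
      ε * ∑' u : Site 4, bubble (Ga n a) (SbfBal n a cE cVH cΛ cR cK cQ α u) (ffOf (hessFF n m 0)) := by
  have hn : 1 ≤ n := NeZero.one_le
  -- one common rate
  obtain ⟨CA, δA, hδA, hAd⟩ := id hGa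
  obtain ⟨Cf, δf, hδf, hSf⟩ := exists_biLoc_SbfBal n a ha cE cVH cΛ cR cK cQ
  set δ₀ : ℝ := min (min δA δf) (min δT δx) with hδ₀def
  have hδ₀ : 0 < δ₀ := lt_min (lt_min hδA hδf) (lt_min hδT hδx)
  have h0A : δ₀ ≤ δA := (min_le_left _ _).trans (min_le_left _ _)
  have h0f : δ₀ ≤ δf := (min_le_left _ _).trans (min_le_right _ _)
  have h0T : δ₀ ≤ δT := (min_le_right _ _).trans (min_le_left _ _)
  have h0x : δ₀ ≤ δx := (min_le_right _ _).trans (min_le_right _ _)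
  have hA : Decays (Ga n a) (|CA|) δ₀ := decays_of_le hAd h0A
  have hV : VertexFamily (fun κ v => ε • SbfBal n a cE cVH cΛ cR cK cQ κ v) 1 (|ε| * |Cf|) δ₀ := by
    intro κ v
    rw [Nat.cast_one, one_smul]
    exact biLoc_smul (biLoc_of_le (hSf κ v) h0f) ε
  obtain ⟨CY, hY⟩ : ∃ CY : ℝ, BiLoc (ffOf (hessFF n m 0)) (0 : Site 4) 0 CY δ₀ :=
    ⟨_, by
      have h := biLoc_ffOf (biLoc_hessFF (d := 3) (L := n) hn m 0 hδ₀.le)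
      rwa [smul_zero] at h⟩
  have hZ : ∀ κ v, BiLoc ((fun κ v => c • TΛ m 0 κ v) κ v) (((1 : ℕ) : ℤ) • v) 0 (|c| * |CT|) δ₀ := by
    intro κ v
    rw [Nat.cast_one, one_smul]
    have h1 := hTloc m 0 κ v
    rw [smul_zero] at h1
    -- re-centre the companion from `(0, 0)` to `(v, 0)`: the amplitude's decay pays for it
    have h2 := biLoc_recentre h1 hδT.le v 0
    rw [sub_self, show l1 (0 : Site 4) = 0 from by simp [l1], add_zero, zero_sub, LamFactor.l1_neg, mul_assoc,
      ← Real.exp_add, show -δT * l1 v + δT * l1 v = 0 by ring, Real.exp_zero, mul_one] at h2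
    exact biLoc_smul (biLoc_of_le h2 h0T) c
  have hX' : ∀ v, BiLoc (X v) (((1 : ℕ) : ℤ) • v) (((1 : ℕ) : ℤ) • v) (|Cx|) δ₀ := by
    intro v
    rw [Nat.cast_one, one_smul]
    exact biLoc_of_le (hX v) h0x
  have R := tsum_resp_eq_zero (N := 1) (Q := 0) X le_rfl hA hV hZ hY hX' hδ₀ hW1 hW2 α
  simp only [tadpole_smul, bubble_smul_left] at R
  -- split the total (both families are summable)
  have sT := (summable_tadpole_T n hGa hδT hTloc α m).mul_left ((1 / 2 : ℝ) * c)
  have sB := (summable_bubble_SbfBal n cE cVH cR cK cQ ha hGa cΛ α m).mul_left ((1 / 2 : ℝ) * ε)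
  have e1 : ∀ u : Site 4, (1 / 2 : ℝ) * (c * tadpole (Ga n a) (TΛ m 0 α u)) -
      (1 / 2) * (ε * bubble (Ga n a) (SbfBal n a cE cVH cΛ cR cK cQ α u) (ffOf (hessFF n m 0))) =
      (1 / 2 : ℝ) * c * tadpole (Ga n a) (TΛ m 0 α u) - (1 / 2 : ℝ) * ε * bubble (Ga n a) (SbfBal n a cE cVH cΛ cR cK cQ α u) (ffOf (hessFF n m 0)) :=
    fun u => by ring
  simp only [e1] at R
  rw [sT.tsum_sub sB, tsum_mul_left, tsum_mul_left] at R
  linear_combination (2 : ℝ) * R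

/-- [folklore] **THE ZERO-MOMENTUM LETTER OF `Nrν`** (`RoadEndLamRow.gLam_row_eq_zero`'s `hZeroν`, BY NAME): under the road's covariance letters
(W1) for `ε • SbfBal` (blocking one, fine bonds) and (W2′) for `−(ε·cΛ₂∕cΛ) • TΛ m 0` against the base Λ-companion, the generator's localisation `hX`,
the Λ₂-companion's localisation socket `hTloc`, `cΛ ≠ 0` and `ε = ±1`:  `Σ'_{u′} Nrν m 0 u′ = 0`. -/
theorem tsum_Nrν_eq_zero (ha : 0 < a) (hGa : Spr (Ga n a)) (hδT : 0 < δT)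
    (hTloc : ∀ m y κ u, BiLoc (TΛ m y κ u) ((n : ℤ) • y) ((n : ℤ) • y) (CT * Real.exp (-δT * l1 ((n : ℤ) • y - u))) δT)
    (hcΛ : cΛ ≠ 0) {ε : ℝ} (hε : ε = 1 ∨ ε = -1) {X : Site 4 → MKer 4 (Fin 4)} {Cx δx : ℝ} (hδx : 0 < δx) (hX : ∀ u, BiLoc (X u) u u Cx δx)
    (hW1 : ∀ u, comp (comp (Ga n a) (divV (fun κ v => ε • SbfBal n a cE cVH cΛ cR cK cQ κ v) u)) (Ga n a) =
      comp (Ga n a) (X u) - comp (X u) (Ga n a))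
    (m : Fin 4)
    (hW2 : ∀ u, divV (fun κ v => (-(ε * (cΛ₂ / cΛ))) • TΛ m 0 κ v) u = comp (X u) (ffOf (hessFF n m 0)) - comp (ffOf (hessFF n m 0)) (X u))
    (μ : Fin 4) :
    ∑' u' : Site 4, Nrν n a cE cVH cΛ cR cK cQ cΛ₂ ωgl TΛ μ m 0 u' = 0 := by
  have hW := ward_total n cE cVH cΛ cR cK cQ ha hGa hδT hTloc ε (-(ε * (cΛ₂ / cΛ))) hδx hX hW1 m hW2 μ
  have hε2 : ε * ε = 1 := by rcases hε with h | h <;> rw [h] <;> norm_num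
  set T : ℝ := ∑' u : Site 4, tadpole (Ga n a) (TΛ m 0 μ u) with hT
  set B : ℝ := ∑' u : Site 4, bubble (Ga n a) (SbfBal n a cE cVH cΛ cR cK cQ μ u) (ffOf (hessFF n m 0)) with hB
  -- from the Ward total: `cΛ·B + cΛ₂·T = 0`
  have key : cΛ * B + cΛ₂ * T = 0 := by
    have h1 : ε * (-(ε * (cΛ₂ / cΛ)) * T) = ε * (ε * B) := by rw [hW]
    have h2 : cΛ₂ / cΛ * T = -B := by nlinarith [h1, hε2]
    field_simp at h2
    linarith
  -- the summand, split into the Ward part and the `cΛ²` cross term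
  have e : ∀ u : Site 4, Nrν n a cE cVH cΛ cR cK cQ cΛ₂ ωgl TΛ μ m 0 u =
      (ωgl * ((n : ℝ) ^ 8)⁻¹ * cΛ * (1 / 2 : ℝ)) * bubble (Ga n a) (SbfBal n a cE cVH cΛ cR cK cQ μ u) (ffOf (hessFF n m 0))
        + (ωgl * ((n : ℝ) ^ 8)⁻¹ * cΛ₂ * (1 / 2 : ℝ)) * tadpole (Ga n a) (TΛ m 0 μ u)
        - (ωgl * ((n : ℝ) ^ 8)⁻¹ * cΛ * (1 / 2 : ℝ)) * (cΛ * bubble (Ga n a) (SbL n μ u) (ffOf (hessFF n m 0))) := by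
    intro u
    rw [cΛ_mul_bubble_SbL n cE cVH cΛ cR cK cQ ha hGa μ m u]
    simp only [Nrν, SbfBal_sub_SbL_eq]
    ring
  have sB := summable_bubble_SbfBal n cE cVH cR cK cQ ha hGa cΛ μ m
  have sT := summable_tadpole_T n hGa hδT hTloc μ m
  have sL := (summable_bubble_SbL n cΛ ha hGa hcΛ μ m).mul_left cΛ
  rw [tsum_congr e, ((sB.mul_left _).add (sT.mul_left _)).tsum_sub (sL.mul_left _), (sB.mul_left _).tsum_add (sT.mul_left _),
    tsum_mul_left, tsum_mul_left, tsum_mul_left, tsum_mul_left, tsum_bubble_SbL_eq_zero n hGa μ m]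
  linear_combination (ωgl * ((n : ℝ) ^ 8)⁻¹ * (1 / 2 : ℝ)) * key

/-- [folklore] **THE ZERO-MOMENTUM LETTER OF `Nrμ`** (`hZeroμ`, BY NAME; the companion sits in the first bubble slot — `bubble_comm` — and no Λ-sector
cross term occurs): `Σ'_{u′} Nrμ m 0 u′ = 0` under the same letters. -/
theorem tsum_Nrμ_eq_zero (ha : 0 < a) (hGa : Spr (Ga n a)) (hδT : 0 < δT)
    (hTloc : ∀ m y κ u, BiLoc (TΛ m y κ u) ((n : ℤ) • y) ((n : ℤ) • y) (CT * Real.exp (-δT * l1 ((n : ℤ) • y - u))) δT)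
    (hcΛ : cΛ ≠ 0) {ε : ℝ} (hε : ε = 1 ∨ ε = -1) {X : Site 4 → MKer 4 (Fin 4)} {Cx δx : ℝ} (hδx : 0 < δx) (hX : ∀ u, BiLoc (X u) u u Cx δx)
    (hW1 : ∀ u, comp (comp (Ga n a) (divV (fun κ v => ε • SbfBal n a cE cVH cΛ cR cK cQ κ v) u)) (Ga n a) =
      comp (Ga n a) (X u) - comp (X u) (Ga n a))
    (m : Fin 4)
    (hW2 : ∀ u, divV (fun κ v => (-(ε * (cΛ₂ / cΛ))) • TΛ m 0 κ v) u = comp (X u) (ffOf (hessFF n m 0)) - comp (ffOf (hessFF n m 0)) (X u))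
    (ν : Fin 4) :
    ∑' u' : Site 4, Nrμ n a cE cVH cΛ cR cK cQ cΛ₂ ωgl TΛ ν m 0 u' = 0 := by
  have hW := ward_total n cE cVH cΛ cR cK cQ ha hGa hδT hTloc ε (-(ε * (cΛ₂ / cΛ))) hδx hX hW1 m hW2 ν
  have hε2 : ε * ε = 1 := by rcases hε with h | h <;> rw [h] <;> norm_num
  set T : ℝ := ∑' u : Site 4, tadpole (Ga n a) (TΛ m 0 ν u) with hT
  set B : ℝ := ∑' u : Site 4, bubble (Ga n a) (SbfBal n a cE cVH cΛ cR cK cQ ν u) (ffOf (hessFF n m 0)) with hB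
  have key : cΛ * B + cΛ₂ * T = 0 := by
    have h1 : ε * (-(ε * (cΛ₂ / cΛ)) * T) = ε * (ε * B) := by rw [hW]
    have h2 : cΛ₂ / cΛ * T = -B := by nlinarith [h1, hε2]
    field_simp at h2
    linarith
  have e : ∀ u : Site 4, Nrμ n a cE cVH cΛ cR cK cQ cΛ₂ ωgl TΛ ν m 0 u =
      (ωgl * ((n : ℝ) ^ 8)⁻¹ * cΛ * (1 / 2 : ℝ)) * bubble (Ga n a) (SbfBal n a cE cVH cΛ cR cK cQ ν u) (ffOf (hessFF n m 0))
        + (ωgl * ((n : ℝ) ^ 8)⁻¹ * cΛ₂ * (1 / 2 : ℝ)) * tadpole (Ga n a) (TΛ m 0 ν u) := by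
    intro u
    rw [← bubble_comm hGa (loc_Y n m 0) (loc_SbfBal n cE cVH cR cK cQ ha cΛ ν u)]
    simp only [Nrμ]
    ring
  have sB := summable_bubble_SbfBal n cE cVH cR cK cQ ha hGa cΛ ν m
  have sT := summable_tadpole_T n hGa hδT hTloc ν m
  rw [tsum_congr e, (sB.mul_left _).tsum_add (sT.mul_left _), tsum_mul_left, tsum_mul_left]
  linear_combination (ωgl * ((n : ℝ) ^ 8)⁻¹ * (1 / 2 : ℝ)) * key

end Zero

end Summit.QuantumFields.BalabanUV.Beta.D1BFx.LamPartnerZero
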